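import Summits.Ventures.PercRepro.LemmaBPlusK5Def

/-!
# Faces of `K₅`: kernel slices 8 … 11 (part C)

Each theorem is one `decide +kernel` at default heartbeats (≈ 55 s: the 1024-row table of the marking
plus ≤ 22 000 face points in sub-mask loops); generated by `tools/gen_k5.py`.
-/

namespace PercRepro

namespace Examples

open MultiGraph

/-- Slice 8: joins `u ∈ [474, 491)` of the faces of `K₅` (21465 face points). -/
theorem k5_slice_8 : k5.FacesSRange ![0, 1, 2, 3] 474 491 := by decide +kernel

/-- Slice 9: joins `u ∈ [491, 502)` of the faces of `K₅` (20655 face points). -/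
theorem k5_slice_9 : k5.FacesSRange ![0, 1, 2, 3] 491 502 := by decide +kernel

/-- Slice 10: joins `u ∈ [502, 508)` of the faces of `K₅` (20412 face points). -/
theorem k5_slice_10 : k5.FacesSRange ![0, 1, 2, 3] 502 508 := by decide +kernel

/-- Slice 11: joins `u ∈ [508, 511)` of the faces of `K₅` (15309 face points). -/
theorem k5_slice_11 : k5.FacesSRange ![0, 1, 2, 3] 508 511 := by decide +kernel

end Examples

end PercRepro
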